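import Summits.Ventures.PercRepro.Defs

/-!
# Conditioning the product Bernoulli law on one edge

Conditioning the product law with edge probabilities `p` on `{e open}` (resp. `{e closed}`) gives
the product law with the single weight `p e` replaced by `1` (resp. `0`), i.e.
`Function.update p e 1` / `Function.update p e 0`: only the weights change, never the graph.

* `weight_split`, `prob_split`: `P_p(A) = p_e · P_{p[e:=1]}(A) + (1 - p_e) · P_{p[e:=0]}(A)`;
* `prob_inter_open`, `prob_inter_closed`: `P_p(A ∩ {e open}) = p_e · P_{p[e:=1]}(A)` and
  `P_p(A ∩ {e closed}) = (1 - p_e) · P_{p[e:=0]}(A)`;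
* `prob_open`, `prob_closed`: the one-edge marginals.

Together with the contraction lemma `MultiGraph.conn_update_true_iff` of
`Summits.Ventures.PercRepro.Graph` this is the engine of edge-induction proofs.
-/

namespace PercRepro

open Finset

variable {E : Type*} [Fintype E] [DecidableEq E]

/-- Product of the edge factors of `ω` over all edges except `e`. -/
def weightErase (p : E → ℝ) (e : E) (ω : Config E) : ℝ :=
  ∏ e' ∈ univ.erase e, if ω e' then p e' else 1 - p e'

/-- The weight factors as (factor of `e`) × (product over the other edges). -/
theorem weight_eq_mul_weightErase (p : E → ℝ) (e : E) (ω : Config E) :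
    weight p ω = (if ω e then p e else 1 - p e) * weightErase p e ω := by
  unfold weight weightErase
  exact (Finset.mul_prod_erase univ (fun e => if ω e then p e else 1 - p e) (mem_univ e)).symm

/-- `weightErase p e` does not depend on `p e`. -/
theorem weightErase_update (p : E → ℝ) (e : E) (x : ℝ) (ω : Config E) :
    weightErase (Function.update p e x) e ω = weightErase p e ω := by
  unfold weightErase
  refine Finset.prod_congr rfl fun e' he' => ?_
  have h : e' ≠ e := (Finset.mem_erase.1 he').1
  simp [Function.update_of_ne h]

/-- The weight under `p[e := 1]` is the weight of the other edges if `e` is open, `0` otherwise. -/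
theorem weight_update_one (p : E → ℝ) (e : E) (ω : Config E) :
    weight (Function.update p e 1) ω = if ω e then weightErase p e ω else 0 := by
  rw [weight_eq_mul_weightErase _ e, weightErase_update]
  cases h : ω e <;> simp

/-- The weight under `p[e := 0]` is the weight of the other edges if `e` is closed, `0` otherwise. -/
theorem weight_update_zero (p : E → ℝ) (e : E) (ω : Config E) :
    weight (Function.update p e 0) ω = if ω e then 0 else weightErase p e ω := by
  rw [weight_eq_mul_weightErase _ e, weightErase_update]
  cases h : ω e <;> simp

/-- The one-edge splitting identity, pointwise in `ω`:
`w_p(ω) = p_e · w_{p[e:=1]}(ω) + (1 - p_e) · w_{p[e:=0]}(ω)`. -/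
theorem weight_split (p : E → ℝ) (e : E) (ω : Config E) :
    weight p ω = p e * weight (Function.update p e 1) ω
      + (1 - p e) * weight (Function.update p e 0) ω := by
  rw [weight_update_one, weight_update_zero, weight_eq_mul_weightErase p e]
  cases h : ω e <;> simp

/-- **Conditioning on one edge**:
`P_p(A) = p_e · P_{p[e:=1]}(A) + (1 - p_e) · P_{p[e:=0]}(A)`. -/
theorem prob_split (p : E → ℝ) (e : E) (A : Set (Config E)) :
    prob p A = p e * prob (Function.update p e 1) A
      + (1 - p e) * prob (Function.update p e 0) A := by
  unfold prob
  rw [Finset.mul_sum, Finset.mul_sum, ← Finset.sum_add_distrib]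
  refine Finset.sum_congr rfl fun ω _ => ?_
  by_cases h : ω ∈ A
  · simp only [Set.indicator_of_mem h]
    exact weight_split p e ω
  · simp [Set.indicator_of_notMem h]

/-- `P_p(A ∩ {e open}) = p_e · P_{p[e:=1]}(A)`. -/
theorem prob_inter_open (p : E → ℝ) (e : E) (A : Set (Config E)) :
    prob p (A ∩ {ω | ω e = true}) = p e * prob (Function.update p e 1) A := by
  unfold prob
  rw [Finset.mul_sum]
  refine Finset.sum_congr rfl fun ω _ => ?_
  by_cases hA : ω ∈ A <;> cases h : ω e <;>
    simp [Set.indicator, hA, h, weight_update_one, weight_eq_mul_weightErase p e]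

/-- `P_p(A ∩ {e closed}) = (1 - p_e) · P_{p[e:=0]}(A)`. -/
theorem prob_inter_closed (p : E → ℝ) (e : E) (A : Set (Config E)) :
    prob p (A ∩ {ω | ω e = false}) = (1 - p e) * prob (Function.update p e 0) A := by
  unfold prob
  rw [Finset.mul_sum]
  refine Finset.sum_congr rfl fun ω _ => ?_
  by_cases hA : ω ∈ A <;> cases h : ω e <;>
    simp [Set.indicator, hA, h, weight_update_zero, weight_eq_mul_weightErase p e]

/-- The marginal: `P_p(e open) = p_e`. -/
theorem prob_open (p : E → ℝ) (e : E) : prob p {ω | ω e = true} = p e := by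
  have h := prob_inter_open p e Set.univ
  rwa [Set.univ_inter, prob_univ, mul_one] at h

/-- The marginal: `P_p(e closed) = 1 - p_e`. -/
theorem prob_closed (p : E → ℝ) (e : E) : prob p {ω | ω e = false} = 1 - p e := by
  have h := prob_inter_closed p e Set.univ
  rwa [Set.univ_inter, prob_univ, mul_one] at h

/-- Under `p[e := 1]` the event `{e open}` is sure. -/
theorem prob_update_one_inter_open (p : E → ℝ) (e : E) (A : Set (Config E)) :
    prob (Function.update p e 1) (A ∩ {ω | ω e = true}) = prob (Function.update p e 1) A := by
  unfold prob
  refine Finset.sum_congr rfl fun ω _ => ?_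
  by_cases hA : ω ∈ A <;> cases h : ω e <;> simp [Set.indicator, hA, h, weight_update_one]

/-- Under `p[e := 0]` the event `{e closed}` is sure. -/
theorem prob_update_zero_inter_closed (p : E → ℝ) (e : E) (A : Set (Config E)) :
    prob (Function.update p e 0) (A ∩ {ω | ω e = false}) = prob (Function.update p e 0) A := by
  unfold prob
  refine Finset.sum_congr rfl fun ω _ => ?_
  by_cases hA : ω ∈ A <;> cases h : ω e <;> simp [Set.indicator, hA, h, weight_update_zero]


/-! ### Monotonicity in the edge probabilities

For an increasing event, raising an edge probability cannot decrease the probability (K4 of the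
classical toolbox).  Proof: by `prob_split` the probability is affine in `p e` with slope
`P_{p[e:=1]}(A) - P_{p[e:=0]}(A)`, and this slope is nonnegative because flipping the state of `e`
is a weight-preserving involution of the configurations that maps `A ∩ {e closed}` into
`A ∩ {e open}`.
-/

/-- `weightErase p e ω` is nonnegative. -/
theorem weightErase_nonneg {p : E → ℝ} (hp : IsProb p) (e : E) (ω : Config E) :
    0 ≤ weightErase p e ω :=
  Finset.prod_nonneg fun e' _ => by
    split_ifs
    · exact hp.nonneg e'
    · exact hp.one_sub_nonneg e'

/-- Flipping the state of the edge `e` in the configuration `ω`. -/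
def flipEdge (e : E) (ω : Config E) : Config E := Function.update ω e (!ω e)

omit [Fintype E] in
/-- The flipped edge has the opposite state. -/
@[simp] theorem flipEdge_apply_self (e : E) (ω : Config E) : flipEdge e ω e = !ω e := by
  simp [flipEdge]

omit [Fintype E] in
/-- The other edges are unchanged by the flip. -/
theorem flipEdge_apply_of_ne {e e' : E} (h : e' ≠ e) (ω : Config E) : flipEdge e ω e' = ω e' := by
  simp [flipEdge, Function.update_of_ne h]

omit [Fintype E] in
/-- Flipping twice is the identity. -/
theorem flipEdge_flipEdge (e : E) (ω : Config E) : flipEdge e (flipEdge e ω) = ω := by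
  simp [flipEdge, Function.update_idem]

omit [Fintype E] in
/-- `flipEdge e` is an involution of the configuration space. -/
theorem flipEdge_involutive (e : E) : Function.Involutive (flipEdge e) :=
  flipEdge_flipEdge e

/-- The weight of the other edges is invariant under flipping `e`. -/
theorem weightErase_flipEdge (p : E → ℝ) (e : E) (ω : Config E) :
    weightErase p e (flipEdge e ω) = weightErase p e ω := by
  unfold weightErase
  refine Finset.prod_congr rfl fun e' he' => ?_
  rw [flipEdge_apply_of_ne (Finset.mem_erase.1 he').1]

omit [Fintype E] in
/-- If `e` is open in `ω`, flipping it closes it, which gives a smaller configuration. -/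
theorem flipEdge_le_of_eq_true {e : E} {ω : Config E} (h : ω e = true) : flipEdge e ω ≤ ω := by
  intro e'
  by_cases he : e' = e
  · subst he
    simp [h]
  · simp [flipEdge_apply_of_ne he]

/-- The weight under `p[e := 0]`, as an indicator of `A ∩ {e closed}` for the weight of the other
edges. -/
theorem indicator_weight_update_zero (p : E → ℝ) (e : E) (A : Set (Config E)) (ω : Config E) :
    A.indicator (weight (Function.update p e 0)) ω =
      (A ∩ {ω | ω e = false}).indicator (weightErase p e) ω := by
  by_cases hA : ω ∈ A <;> cases h : ω e <;> simp [Set.indicator, hA, h, weight_update_zero]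

/-- The weight under `p[e := 1]`, as an indicator of `A ∩ {e open}` for the weight of the other
edges. -/
theorem indicator_weight_update_one (p : E → ℝ) (e : E) (A : Set (Config E)) (ω : Config E) :
    A.indicator (weight (Function.update p e 1)) ω =
      (A ∩ {ω | ω e = true}).indicator (weightErase p e) ω := by
  by_cases hA : ω ∈ A <;> cases h : ω e <;> simp [Set.indicator, hA, h, weight_update_one]

/-- For an increasing event, surely opening `e` beats surely closing it:
`P_{p[e:=0]}(A) ≤ P_{p[e:=1]}(A)`. -/
theorem prob_update_zero_le_prob_update_one {p : E → ℝ} (hp : IsProb p) (e : E)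
    {A : Set (Config E)} (hA : IsUpperSet A) :
    prob (Function.update p e 0) A ≤ prob (Function.update p e 1) A := by
  unfold prob
  simp only [indicator_weight_update_zero, indicator_weight_update_one]
  rw [← (flipEdge_involutive e).bijective.sum_comp]
  refine Finset.sum_le_sum fun ω _ => ?_
  rw [← Set.indicator_comp_right (flipEdge e)]
  have hcomp : weightErase p e ∘ flipEdge e = weightErase p e := funext (weightErase_flipEdge p e)
  rw [hcomp]
  refine Set.indicator_le_indicator_of_subset ?_ (fun ω => weightErase_nonneg hp e ω) ω
  intro ω' hω'
  obtain ⟨h1, h2⟩ := hω'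
  have he : ω' e = true := by simpa using h2
  exact ⟨hA (flipEdge_le_of_eq_true he) h1, he⟩

/-- Raising one edge probability cannot decrease the probability of an increasing event. -/
theorem prob_le_prob_update {p : E → ℝ} (hp : IsProb p) (e : E) {x : ℝ} (hx : p e ≤ x)
    {A : Set (Config E)} (hA : IsUpperSet A) :
    prob p A ≤ prob (Function.update p e x) A := by
  have h1 := prob_split p e A
  have h2 := prob_split (Function.update p e x) e A
  rw [Function.update_idem, Function.update_idem, Function.update_self] at h2
  have h3 := prob_update_zero_le_prob_update_one hp e hA
  rw [h1, h2]
  nlinarith [mul_nonneg (sub_nonneg.2 hx) (sub_nonneg.2 h3)]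

/-- **Monotonicity in the edge probabilities**: for an increasing event `A` and edge probability
vectors `p ≤ p'` (pointwise), `P_p(A) ≤ P_{p'}(A)`. -/
theorem prob_mono_of_isUpperSet {p p' : E → ℝ} (hp : IsProb p) (hp' : IsProb p') (hle : p ≤ p')
    {A : Set (Config E)} (hA : IsUpperSet A) : prob p A ≤ prob p' A := by
  have key : ∀ S : Finset E, prob p A ≤ prob (fun e => if e ∈ S then p' e else p e) A := by
    intro S
    induction S using Finset.induction_on with
    | empty => simp
    | insert e S he ih =>
      refine ih.trans ?_
      have hq : IsProb (fun e => if e ∈ S then p' e else p e) := fun e => by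
        by_cases h : e ∈ S
        · simpa [h] using hp' e
        · simpa [h] using hp e
      have h := prob_le_prob_update hq e (x := p' e) (by simpa [he] using hle e) hA
      have hfun : Function.update (fun e => if e ∈ S then p' e else p e) e (p' e) =
          fun e' => if e' ∈ insert e S then p' e' else p e' := by
        funext e'
        by_cases h' : e' = e
        · subst h'
          simp
        · simp [h']
      rw [hfun] at h
      exact h
  simpa using key univ

/-- Monotonicity in the edge probabilities for a decreasing event: `p ≤ p'` gives
`P_{p'}(A) ≤ P_p(A)`. -/
theorem prob_anti_of_isLowerSet {p p' : E → ℝ} (hp : IsProb p) (hp' : IsProb p') (hle : p ≤ p')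
    {A : Set (Config E)} (hA : IsLowerSet A) : prob p' A ≤ prob p A := by
  have h := prob_mono_of_isUpperSet hp hp' hle hA.compl
  rw [prob_compl, prob_compl] at h
  linarith


/-! ### Cylinder events: prescribed states on finitely many edges -/

/-- The cylinder event: every edge of `S` is open and every edge of `T` is closed. -/
def cylinder (S T : Finset E) : Set (Config E) :=
  {ω | (∀ e ∈ S, ω e = true) ∧ ∀ e ∈ T, ω e = false}

omit [Fintype E] [DecidableEq E] in
/-- Membership in a cylinder event. -/
theorem mem_cylinder {S T : Finset E} {ω : Config E} :
    ω ∈ cylinder S T ↔ (∀ e ∈ S, ω e = true) ∧ ∀ e ∈ T, ω e = false :=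
  Iff.rfl

/-- **Independence of the edges**: for disjoint edge sets `S`, `T`,
`P_p(S open, T closed) = ∏_{e ∈ S} p_e · ∏_{e ∈ T} (1 - p_e)`. -/
theorem prob_cylinder (p : E → ℝ) {S T : Finset E} (hST : Disjoint S T) :
    prob p (cylinder S T) = (∏ e ∈ S, p e) * ∏ e ∈ T, (1 - p e) := by
  have hpt : ∀ ω : Config E, (cylinder S T).indicator (weight p) ω =
      ∏ e, ((if ω e then p e else 1 - p e) *
        (if e ∈ S then (if ω e then (1 : ℝ) else 0)
          else if e ∈ T then (if ω e then 0 else 1) else 1)) := by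
    intro ω
    rw [Finset.prod_mul_distrib]
    by_cases hω : ω ∈ cylinder S T
    · rw [Set.indicator_of_mem hω]
      have h1 : ∏ e, (if e ∈ S then (if ω e then (1 : ℝ) else 0)
          else if e ∈ T then (if ω e then 0 else 1) else 1) = 1 := by
        refine Finset.prod_eq_one fun e _ => ?_
        obtain ⟨hS, hT⟩ := hω
        by_cases heS : e ∈ S
        · simp [heS, hS e heS]
        · by_cases heT : e ∈ T
          · simp [heS, heT, hT e heT]
          · simp [heS, heT]
      rw [h1, mul_one]
      rfl
    · rw [Set.indicator_of_notMem hω]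
      have h0 : ∏ e, (if e ∈ S then (if ω e then (1 : ℝ) else 0)
          else if e ∈ T then (if ω e then 0 else 1) else 1) = 0 := by
        simp only [cylinder, Set.mem_setOf_eq, not_and_or, not_forall] at hω
        rcases hω with ⟨e, heS, he⟩ | ⟨e, heT, he⟩
        · exact Finset.prod_eq_zero (Finset.mem_univ e) (by simp [heS, he])
        · exact Finset.prod_eq_zero (Finset.mem_univ e)
            (by simp [heT, he, Finset.disjoint_right.1 hST heT])
      rw [h0, mul_zero]
  have hprod := Fintype.prod_sum (fun (e : E) (b : Bool) => (if b then p e else 1 - p e) *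
    (if e ∈ S then (if b then (1 : ℝ) else 0) else if e ∈ T then (if b then 0 else 1) else 1))
  have hsum : ∀ e, (∑ b : Bool, (if b then p e else 1 - p e) *
      (if e ∈ S then (if b then (1 : ℝ) else 0) else if e ∈ T then (if b then 0 else 1) else 1)) =
      if e ∈ S then p e else if e ∈ T then 1 - p e else 1 := by
    intro e
    by_cases heS : e ∈ S
    · simp [heS]
    · by_cases heT : e ∈ T
      · simp [heS, heT]
      · simp [heS, heT]
  have hT : (univ.filter fun e => e ∉ S) ∩ T = T := by
    ext e
    simp only [Finset.mem_inter, Finset.mem_filter, Finset.mem_univ, true_and]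
    exact ⟨fun h => h.2, fun h => ⟨Finset.disjoint_right.1 hST h, h⟩⟩
  unfold prob
  simp only [hpt]
  rw [← hprod, Finset.prod_congr rfl fun e _ => hsum e, Finset.prod_ite, Finset.prod_ite_mem,
    Finset.filter_mem_eq_inter, Finset.univ_inter, hT]

/-- `P_p(S open) = ∏_{e ∈ S} p_e`. -/
theorem prob_cylinder_open (p : E → ℝ) (S : Finset E) :
    prob p {ω | ∀ e ∈ S, ω e = true} = ∏ e ∈ S, p e := by
  have h := prob_cylinder p (S := S) (T := ∅) (Finset.disjoint_empty_right S)
  simpa [cylinder] using h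

/-- `P_p(T closed) = ∏_{e ∈ T} (1 - p_e)`. -/
theorem prob_cylinder_closed (p : E → ℝ) (T : Finset E) :
    prob p {ω | ∀ e ∈ T, ω e = false} = ∏ e ∈ T, (1 - p e) := by
  have h := prob_cylinder p (S := ∅) (T := T) (Finset.disjoint_empty_left T)
  simpa [cylinder] using h

/-! ### Joins and meets of configurations (p1, lean-drafts/p1/Reveal.lean, absorbed verbatim) -/

section BoolConfig

omit [Fintype E] [DecidableEq E] in
/-- Pointwise join of configurations: `(ζ ⊔ ζ') e = true` iff one of them is open at `e`. -/
theorem sup_apply_eq_true_iff {ζ ζ' : Config E} {e : E} :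
    (ζ ⊔ ζ') e = true ↔ ζ e = true ∨ ζ' e = true := by
  simp only [Pi.sup_apply]
  cases ζ e <;> cases ζ' e <;> simp

omit [Fintype E] [DecidableEq E] in
/-- Pointwise meet of configurations: `(ζ ⊓ ζ') e = true` iff both are open at `e`. -/
theorem inf_apply_eq_true_iff {ζ ζ' : Config E} {e : E} :
    (ζ ⊓ ζ') e = true ↔ ζ e = true ∧ ζ' e = true := by
  simp only [Pi.inf_apply]
  cases ζ e <;> cases ζ' e <;> simp

end BoolConfig

end PercRepro
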